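import Summits.Ventures.HSemireg.WedgeHankelRecurrenceNewton
import Summits.Ventures.HSemireg.WedgeHankelRecurrenceSplitting

/-!
# Venture HSemireg — NEWTON INVERSION: THE POWER SUMS `p_1, …, p_d` AS COORDINATES ON THE MONIC POLYNOMIALS OF DEGREE `d`. For a field `K` and `d ∈ ℕ`, with `p_j(m) = dualSeq m m′ j`
# (the `j`-th Newton sum of the monic `m`, = `trace (M_X^j)` by N103, = `Σ λ^j` over the roots by N107), THE FOLLOWING ARE EQUIVALENT: **(i) `1, 2, …, d` are non-zero in `K`**
# (`d <` the characteristic, or characteristic `0`); **(ii) `m ↦ (p_1(m), …, p_d(m))` is INJECTIVE** on monic polynomials of degree `d`; **(iii) it is SURJECTIVE onto `K^d`**.  Under (i) every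
# `d`-tuple is the Newton-sum vector of EXACTLY ONE monic polynomial of degree `d` (Newton's identities inverted, dividing by `j`); if `k ≤ d` vanishes in `K` (characteristic `p ∣ k`) then
# `X^d` and `X^{d−p}(X − 1)^p` have the same Newton sums, and no monic polynomial of degree `d` has `p_1 = … = p_{k−1} = 0`, `p_k = 1`.

HONEST FRAMING. Part of the Lean index of the computation cell `pub-hsemireg` (seat p10 gen 32, Sunday typer «UNIFORM-IN-n»).
LINEAR ALGEBRA OF HANKEL (catalecticant) MATRICES and of polynomials over a field ONLY (`Polynomial.coeff`, `Polynomial.derivative`, the lineage's `dualSeq`): no variety, no cohomology theory,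
no sheaf, no Ext group and no semiregularity map is constructed here; nothing here says that HC / HC_CM / HC_AV holds; no Literature fact is declared or used.  Custodian versions as in
`WedgeHankelSiegelIdeal` (1/3).

WHAT IS IN THE TREE.  N105 (`WedgeHankelRecurrenceNewton`): `newton_dualSeq_derivative` (`Σ_{i ≤ j} m_{d−i} p_{j−i} = (d − j) m_{d−j}`, `j < d`), `sum_coeff_mul_dualSeq_eq_zero` (the tail, `j ≥ d`).
N103 (`WedgeHankelRecurrenceTraceForm`): `dualSeq_derivative_zero` (`p_0 = d`).  N107 (`WedgeHankelRecurrenceSplitting`): `dualSeq_multiset_prod_X_sub_C_derivative` (`p_j(∏_{λ∈s}(X − λ)) = Σ_{λ∈s} λ^j`).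
Mathlib: `Monic.add_of_left`, `natDegree_add_eq_left_of_degree_lt`, `coeff_C_mul_X_pow`, `Finset.sum_eq_sum_Ico_succ_bot`, `ringChar.spec`.
DEDUP ∕ HONESTY: the characteristic-`0` UNIQUENESS statements «two multisets of the same size with the same power sums `p_1, …, p_n` are equal» and «`Tr(A^m) = Tr(B^m)` for `m ≤ n` ⇒ same
characteristic polynomial» are ALREADY in the tree (PROVED Literature `Literature/LinearAlgebra/Matrix/TracePowersDetermineCharpoly.lean`: `multiset_eq_of_forall_sum_map_pow_eq`,
`Matrix.charpoly_eq_charpoly_of_trace_pow_eq`, Cox–Little–O'Shea Ch. 7 §1 Thm. 8) — not restated and not imported here.  What this file adds: the root-free symbol form over ANY field with the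
SHARP hypothesis (i), the EXISTENCE half (surjectivity), and the converse witnesses making (i) ⟺ (ii) ⟺ (iii); `rg` over lean∕Summits + Literature + Mathlib finds no existence∕equivalence statement.
THIS FILE (namespace `Summit.Ventures.HSemireg.Wedge.HankelOuter` continued; PLAIN on TREE N105 + N107; 0 definitions):
* §670 `newton_dualSeq_derivative_of_le` (Newton for `j ≤ d`, the case `j = d` being the tail), `dualSeq_derivative_zero_eq_natDegree` (`p_0 = d`), **`dualSeq_derivative_eq_newton`** (SOLVED FORM
  `p_j = −j·m_{d−j} − Σ_{0<i<j} m_{d−i} p_{j−i}`, `1 ≤ j ≤ d`), **`dualSeq_derivative_eq_of_coeff_eq`** (`p_1, …, p_j` depend only on the top `j` coefficients — any field, no hypothesis on the characteristic).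
* §671 **`eq_of_dualSeq_derivative_eq`** ((i) ⇒ INJECTIVE), `eq_of_dualSeq_derivative_eq_of_charZero`; **`exists_monic_dualSeq_derivative_eq`** ((i) ⇒ SURJECTIVE: coefficient surgery
  `m ↦ m + c·X^{d−j}` fixes `p_1, …, p_{j−1}` and moves `p_j` with slope `−j`), **`existsUnique_monic_dualSeq_derivative_eq`** (BIJECTIVE), `…_of_charZero`.
* §672 the converses: `dualSeq_derivative_X_pow` (`p_j(X^d) = 0`, `j ≥ 1`), **`dualSeq_derivative_X_pow_mul_eq_of_cast_eq_zero`** (`(p : K) = 0`, `p ≥ 1` ⇒ `X^{d−p}(X − 1)^p` and `X^d` have the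
  same Newton sums in every degree `j ≥ 1`, and differ), **`dualSeq_derivative_ne_single_of_cast_eq_zero`** (`(k : K) = 0`, `1 ≤ k ≤ d` ⇒ no monic `m` of degree `d` has `p_j(m) = [j = k]` for
  `1 ≤ j ≤ k`), `exists_ringChar_le_of_cast_eq_zero`, **`forall_cast_ne_zero_iff_injective`**, **`forall_cast_ne_zero_iff_surjective`** (THE EQUIVALENCES (i) ⟺ (ii) ⟺ (iii)).
Nothing Ext-side.  New names only.
-/

open Module Polynomial
open scoped Matrix Polynomial

namespace Summit.Ventures.HSemireg.Wedge.HankelOuter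

open Summit.Ventures.HSemireg.Wedge Summit.Ventures.HSemireg.Wedge.Hankel

variable (K : Type*) [Field K]

/-! ## §670. Newton's identities solved for the coefficients -/

/-- Newton's identity `Σ_{i ≤ j} m_{d−i} · p_{j−i} = (d − j) · m_{d−j}` for EVERY `j ≤ d = deg m` (`m` monic; N105 for `j < d`, and for `j = d` the right side is `0` and the identity is N105's tail
`Σ_{i ≤ d} m_{d−i} p_{d−i} = 0`). -/
theorem newton_dualSeq_derivative_of_le {m : K[X]} (hm : m.Monic) {j : ℕ} (hj : j ≤ m.natDegree) :
    ∑ i ∈ Finset.range (j + 1), m.coeff (m.natDegree - i) * dualSeq K m (derivative m) (j - i) = ((m.natDegree - j : ℕ) : K) * m.coeff (m.natDegree - j) := by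
  rcases hj.lt_or_eq with hlt | heq
  · exact newton_dualSeq_derivative K hm hlt
  · rw [heq, Nat.sub_self, Nat.cast_zero, zero_mul]
    exact sum_coeff_mul_dualSeq_eq_zero K hm (derivative m) le_rfl

/-- `p_0 = d` for `m` monic of POSITIVE degree `d` (N103's `dualSeq_derivative_zero` without the `t + 1` bookkeeping). -/
theorem dualSeq_derivative_zero_eq_natDegree {m : K[X]} (hm : m.Monic) (hd : 0 < m.natDegree) : dualSeq K m (derivative m) 0 = (m.natDegree : K) := by
  obtain ⟨t, ht⟩ : ∃ t, m.natDegree = t + 1 := ⟨m.natDegree - 1, by omega⟩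
  rw [dualSeq_derivative_zero K hm ht, ht, Nat.cast_succ]

/-- **NEWTON SOLVED FOR THE NEXT COEFFICIENT: `p_j = −j · m_{d−j} − Σ_{0 < i < j} m_{d−i} · p_{j−i}`** for `1 ≤ j ≤ d` (`m` monic of degree `d`, `p_k = dualSeq m m′ k`; any field): the `i = 0`
term of Newton's identity is `p_j` (`m_d = 1`) and the `i = j` term is `d · m_{d−j}` (`p_0 = d`). -/
theorem dualSeq_derivative_eq_newton {m : K[X]} (hm : m.Monic) {j : ℕ} (hj1 : 1 ≤ j) (hj : j ≤ m.natDegree) :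
    dualSeq K m (derivative m) j = -(((j : ℕ) : K) * m.coeff (m.natDegree - j)) - ∑ i ∈ Finset.Ico 1 j, m.coeff (m.natDegree - i) * dualSeq K m (derivative m) (j - i) := by
  have h := newton_dualSeq_derivative_of_le K hm hj
  rw [Finset.sum_range_succ, Finset.range_eq_Ico, Finset.sum_eq_sum_Ico_succ_bot (by omega : 0 < j), Nat.sub_zero, hm.coeff_natDegree, one_mul, Nat.sub_self,
    dualSeq_derivative_zero_eq_natDegree K hm (by omega), Nat.cast_sub hj] at h
  linear_combination h

/-- **The first `j` Newton sums depend only on the top `j` coefficients**: if `m₁`, `m₂` are monic of the same degree `d` and `m₁_{d−i} = m₂_{d−i}` for `1 ≤ i ≤ j` (`j ≤ d`), then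
`p_i(m₁) = p_i(m₂)` for every `i ≤ j` — any field, NO hypothesis on the characteristic (induction on the solved form). -/
theorem dualSeq_derivative_eq_of_coeff_eq {m₁ m₂ : K[X]} (hm₁ : m₁.Monic) (hm₂ : m₂.Monic) (hd : m₁.natDegree = m₂.natDegree) {j : ℕ} (hj : j ≤ m₁.natDegree)
    (hc : ∀ i, 1 ≤ i → i ≤ j → m₁.coeff (m₁.natDegree - i) = m₂.coeff (m₂.natDegree - i)) {i : ℕ} (hi : i ≤ j) :
    dualSeq K m₁ (derivative m₁) i = dualSeq K m₂ (derivative m₂) i := by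
  induction i using Nat.strong_induction_on with
  | _ i ih =>
    rcases Nat.eq_zero_or_pos i with rfl | hpos
    · rcases Nat.eq_zero_or_pos m₁.natDegree with h0 | hdpos
      · rw [Polynomial.eq_one_of_monic_natDegree_zero hm₁ h0, Polynomial.eq_one_of_monic_natDegree_zero hm₂ (hd ▸ h0)]
      · rw [dualSeq_derivative_zero_eq_natDegree K hm₁ hdpos, dualSeq_derivative_zero_eq_natDegree K hm₂ (hd ▸ hdpos), hd]
    · rw [dualSeq_derivative_eq_newton K hm₁ hpos (by omega), dualSeq_derivative_eq_newton K hm₂ hpos (by omega), hc i hpos hi]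
      congr 1
      refine Finset.sum_congr rfl fun l hl => ?_
      rw [Finset.mem_Ico] at hl
      rw [hc l hl.1 (by omega), ih (i - l) (by omega) (by omega)]

/-! ## §671. Injectivity and surjectivity when `1, …, d` are non-zero in `K` -/

/-- **NEWTON INVERSION — UNIQUENESS: if `1, 2, …, d` are non-zero in `K`, a monic polynomial of degree `d` is determined by its Newton sums `p_1, …, p_d`** (`p_j = dualSeq m m′ j`; root-free,
any field; in characteristic `0` the multiset ∕ matrix forms are Literature `TracePowersDetermineCharpoly`).  From the solved form, `j · m₁_{d−j} = j · m₂_{d−j}` inductively, and `j` is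
invertible. -/
theorem eq_of_dualSeq_derivative_eq {m₁ m₂ : K[X]} (hm₁ : m₁.Monic) (hm₂ : m₂.Monic) (hd : m₁.natDegree = m₂.natDegree)
    (hchar : ∀ k : ℕ, 1 ≤ k → k ≤ m₁.natDegree → (k : K) ≠ 0)
    (hp : ∀ j, 1 ≤ j → j ≤ m₁.natDegree → dualSeq K m₁ (derivative m₁) j = dualSeq K m₂ (derivative m₂) j) : m₁ = m₂ := by
  have hc : ∀ j, j ≤ m₁.natDegree → m₁.coeff (m₁.natDegree - j) = m₂.coeff (m₂.natDegree - j) := by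
    intro j
    induction j using Nat.strong_induction_on with
    | _ j ih =>
      intro hj
      rcases Nat.eq_zero_or_pos j with rfl | hpos
      · rw [Nat.sub_zero, Nat.sub_zero, hm₁.coeff_natDegree, hm₂.coeff_natDegree]
      · have h1 := dualSeq_derivative_eq_newton K hm₁ hpos hj
        have h2 := dualSeq_derivative_eq_newton K hm₂ hpos (hd ▸ hj)
        have hS : ∑ i ∈ Finset.Ico 1 j, m₁.coeff (m₁.natDegree - i) * dualSeq K m₁ (derivative m₁) (j - i)
            = ∑ i ∈ Finset.Ico 1 j, m₂.coeff (m₂.natDegree - i) * dualSeq K m₂ (derivative m₂) (j - i) :=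
          Finset.sum_congr rfl fun i hi => by
            rw [Finset.mem_Ico] at hi
            rw [ih i hi.2 (by omega), hp (j - i) (by omega) (by omega)]
        rw [hp j hpos hj, h2, hS] at h1
        have h3 : ((j : ℕ) : K) * m₁.coeff (m₁.natDegree - j) = ((j : ℕ) : K) * m₂.coeff (m₂.natDegree - j) := by linear_combination h1
        exact mul_left_cancel₀ (hchar j hpos hj) h3
  ext n
  by_cases hn : n ≤ m₁.natDegree
  · have h := hc (m₁.natDegree - n) (Nat.sub_le _ _)
    rwa [Nat.sub_sub_self hn, show m₂.natDegree - (m₁.natDegree - n) = n by omega] at h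
  · rw [Polynomial.coeff_eq_zero_of_natDegree_lt (by omega), Polynomial.coeff_eq_zero_of_natDegree_lt (by omega)]

/-- Characteristic `0`: a monic polynomial is determined by its degree and its Newton sums `p_1, …, p_d`. -/
theorem eq_of_dualSeq_derivative_eq_of_charZero [CharZero K] {m₁ m₂ : K[X]} (hm₁ : m₁.Monic) (hm₂ : m₂.Monic) (hd : m₁.natDegree = m₂.natDegree)
    (hp : ∀ j, 1 ≤ j → j ≤ m₁.natDegree → dualSeq K m₁ (derivative m₁) j = dualSeq K m₂ (derivative m₂) j) : m₁ = m₂ :=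
  eq_of_dualSeq_derivative_eq K hm₁ hm₂ hd (fun k hk _ => Nat.cast_ne_zero.mpr (by omega)) hp

/-- **NEWTON INVERSION — EXISTENCE: if `1, 2, …, d` are non-zero in `K`, EVERY `d`-tuple `(q_1, …, q_d)` is the Newton-sum vector of a monic polynomial of degree `d`.**  Induction on the
number of prescribed sums: given `m` with `p_i(m) = q_i` for `i < j`, the polynomial `m + c · X^{d−j}` has the same `p_1, …, p_{j−1}` (§670: they see only the top `j − 1` coefficients) and
`p_j = −j (m_{d−j} + c) − Σ_{0<i<j} m_{d−i} q_{j−i}`, which `c` can make equal to `q_j` because `j` is invertible. -/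
theorem exists_monic_dualSeq_derivative_eq (d : ℕ) (hchar : ∀ k : ℕ, 1 ≤ k → k ≤ d → (k : K) ≠ 0) (q : ℕ → K) :
    ∃ m : K[X], m.Monic ∧ m.natDegree = d ∧ ∀ j, 1 ≤ j → j ≤ d → dualSeq K m (derivative m) j = q j := by
  suffices h : ∀ n, n ≤ d → ∃ m : K[X], m.Monic ∧ m.natDegree = d ∧ ∀ j, 1 ≤ j → j ≤ n → dualSeq K m (derivative m) j = q j from h d le_rfl
  intro n
  induction n with
  | zero => exact fun _ => ⟨Polynomial.X ^ d, Polynomial.monic_X_pow d, Polynomial.natDegree_X_pow d, fun j hj1 hj0 => by omega⟩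
  | succ n ih =>
    intro hn
    obtain ⟨m, hm, hmd, hmq⟩ := ih (by omega)
    -- the correction term and the corrected polynomial
    set S : K := ∑ i ∈ Finset.Ico 1 (n + 1), m.coeff (d - i) * q (n + 1 - i) with hS
    set c : K := -((((n + 1 : ℕ) : K))⁻¹ * (q (n + 1) + S)) - m.coeff (d - (n + 1)) with hcdef
    have hdeg : (C c * Polynomial.X ^ (d - (n + 1))).degree < m.degree := by
      rw [Polynomial.degree_eq_natDegree hm.ne_zero, hmd]
      exact (Polynomial.degree_C_mul_X_pow_le _ _).trans_lt (by exact_mod_cast (show d - (n + 1) < d by omega))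
    have hm₂ : (m + C c * Polynomial.X ^ (d - (n + 1))).Monic := hm.add_of_left hdeg
    have hm₂d : (m + C c * Polynomial.X ^ (d - (n + 1))).natDegree = d := by rw [Polynomial.natDegree_add_eq_left_of_degree_lt hdeg, hmd]
    have htop : ∀ i, 1 ≤ i → i ≤ n → (m + C c * Polynomial.X ^ (d - (n + 1))).coeff (d - i) = m.coeff (d - i) := fun i hi1 hin => by
      rw [Polynomial.coeff_add, Polynomial.coeff_C_mul_X_pow, if_neg (by omega), add_zero]
    have hnew : (m + C c * Polynomial.X ^ (d - (n + 1))).coeff (d - (n + 1)) = m.coeff (d - (n + 1)) + c := by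
      rw [Polynomial.coeff_add, Polynomial.coeff_C_mul_X_pow, if_pos rfl]
    -- the first `n` Newton sums are unchanged
    have hlow : ∀ i, i ≤ n → dualSeq K (m + C c * Polynomial.X ^ (d - (n + 1))) (derivative (m + C c * Polynomial.X ^ (d - (n + 1)))) i = dualSeq K m (derivative m) i :=
      fun i hin => dualSeq_derivative_eq_of_coeff_eq K hm₂ hm (hm₂d.trans hmd.symm) (j := n) (by omega) (fun l hl1 hln => by rw [hm₂d, hmd]; exact htop l hl1 hln) hin
    refine ⟨m + C c * Polynomial.X ^ (d - (n + 1)), hm₂, hm₂d, fun j hj1 hj => ?_⟩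
    rcases (show j ≤ n ∨ j = n + 1 by omega) with hjn | rfl
    · rw [hlow j hjn, hmq j hj1 hjn]
    · rw [dualSeq_derivative_eq_newton K hm₂ (by omega) (by omega), hm₂d, hnew]
      have hS2 : ∑ i ∈ Finset.Ico 1 (n + 1), (m + C c * Polynomial.X ^ (d - (n + 1))).coeff (d - i)
          * dualSeq K (m + C c * Polynomial.X ^ (d - (n + 1))) (derivative (m + C c * Polynomial.X ^ (d - (n + 1)))) (n + 1 - i) = S :=
        Finset.sum_congr rfl fun i hi => by
          rw [Finset.mem_Ico] at hi
          rw [htop i hi.1 (by omega), hlow (n + 1 - i) (by omega), hmq (n + 1 - i) (by omega) (by omega)]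
      rw [hS2, hcdef]
      have hne : ((n + 1 : ℕ) : K) ≠ 0 := hchar (n + 1) (by omega) hn
      field_simp
      ring

/-- **NEWTON INVERSION (BIJECTION): if `1, …, d` are non-zero in `K`, every `d`-tuple `(q_1, …, q_d)` is the Newton-sum vector of EXACTLY ONE monic polynomial of degree `d` over `K`.** -/
theorem existsUnique_monic_dualSeq_derivative_eq (d : ℕ) (hchar : ∀ k : ℕ, 1 ≤ k → k ≤ d → (k : K) ≠ 0) (q : ℕ → K) :
    ∃! m : K[X], m.Monic ∧ m.natDegree = d ∧ ∀ j, 1 ≤ j → j ≤ d → dualSeq K m (derivative m) j = q j := by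
  obtain ⟨m, hm, hmd, hmq⟩ := exists_monic_dualSeq_derivative_eq K d hchar q
  refine ⟨m, ⟨hm, hmd, hmq⟩, fun m₂ ⟨hm₂, hm₂d, hm₂q⟩ => ?_⟩
  exact eq_of_dualSeq_derivative_eq K hm₂ hm (hm₂d.trans hmd.symm) (fun k hk hkd => hchar k hk (hm₂d ▸ hkd)) fun j hj1 hj => by rw [hm₂q j hj1 (hm₂d ▸ hj), hmq j hj1 (hm₂d ▸ hj)]

/-- Characteristic `0`: the Newton sums `(p_1, …, p_d)` are a bijection from monic polynomials of degree `d` onto `K^d`. -/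
theorem existsUnique_monic_dualSeq_derivative_eq_of_charZero [CharZero K] (d : ℕ) (q : ℕ → K) :
    ∃! m : K[X], m.Monic ∧ m.natDegree = d ∧ ∀ j, 1 ≤ j → j ≤ d → dualSeq K m (derivative m) j = q j :=
  existsUnique_monic_dualSeq_derivative_eq K d (fun k hk _ => Nat.cast_ne_zero.mpr (by omega)) q

/-! ## §672. The converses: what fails when some `k ≤ d` vanishes in `K` -/

/-- The Newton sums of `X^d` vanish in positive degree: `p_j(X^d) = 0` for `j ≥ 1` (all roots are `0`). -/
theorem dualSeq_derivative_X_pow {d j : ℕ} (hj : 1 ≤ j) : dualSeq K ((Polynomial.X : K[X]) ^ d) (derivative ((Polynomial.X : K[X]) ^ d)) j = 0 := by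
  have h := congrFun (dualSeq_multiset_prod_X_sub_C_derivative K (d • ({0} : Multiset K))) j
  rw [Multiset.map_nsmul, Multiset.map_singleton, map_zero, sub_zero, Multiset.prod_nsmul, Multiset.prod_singleton] at h
  rw [h, Multiset.map_nsmul, Multiset.map_singleton, zero_pow (by omega), Multiset.sum_nsmul, Multiset.sum_singleton, smul_zero]

/-- **Injectivity FAILS when some `p ≥ 1` vanishes in `K`: `X^{d−p} (X − 1)^p` and `X^d` are distinct monic polynomials (of degree `d` when `p ≤ d`) with the SAME Newton sums `p_j` in every
degree `j ≥ 1`** (both sums are `(d − p)·0^j + p·1^j = p = 0`; no primality needed). -/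
theorem dualSeq_derivative_X_pow_mul_eq_of_cast_eq_zero {p : ℕ} (d : ℕ) (hp : (p : K) = 0) (hp1 : 1 ≤ p) {j : ℕ} (hj : 1 ≤ j) :
    dualSeq K ((Polynomial.X : K[X]) ^ (d - p) * (Polynomial.X - C 1) ^ p) (derivative ((Polynomial.X : K[X]) ^ (d - p) * (Polynomial.X - C 1) ^ p)) j
      = dualSeq K ((Polynomial.X : K[X]) ^ d) (derivative ((Polynomial.X : K[X]) ^ d)) j ∧
    (Polynomial.X : K[X]) ^ (d - p) * (Polynomial.X - C 1) ^ p ≠ (Polynomial.X : K[X]) ^ d := by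
  refine ⟨?_, fun h => ?_⟩
  · have h := congrFun (dualSeq_multiset_prod_X_sub_C_derivative K ((d - p) • ({0} : Multiset K) + p • ({1} : Multiset K))) j
    rw [Multiset.map_add, Multiset.map_nsmul, Multiset.map_nsmul, Multiset.map_singleton, Multiset.map_singleton, map_zero, sub_zero, Multiset.prod_add, Multiset.prod_nsmul,
      Multiset.prod_nsmul, Multiset.prod_singleton, Multiset.prod_singleton] at h
    rw [h, dualSeq_derivative_X_pow K hj, Multiset.map_add, Multiset.map_nsmul, Multiset.map_nsmul, Multiset.map_singleton, Multiset.map_singleton, zero_pow (by omega), one_pow,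
      Multiset.sum_add, Multiset.sum_nsmul, Multiset.sum_nsmul, Multiset.sum_singleton, Multiset.sum_singleton, smul_zero, zero_add, nsmul_eq_mul, mul_one, hp]
  · -- evaluate at `1`: the left side vanishes, `X^d` does not
    have h1 := congrArg (Polynomial.eval (1 : K)) h
    rw [Polynomial.eval_mul, Polynomial.eval_pow, Polynomial.eval_pow, Polynomial.eval_sub, Polynomial.eval_X, Polynomial.eval_C, sub_self, zero_pow (by omega), mul_zero,
      Polynomial.eval_pow, Polynomial.eval_X, one_pow] at h1
    exact zero_ne_one h1

/-- **Surjectivity FAILS when `k ≤ d` vanishes in `K`: no monic polynomial of degree `d` has `p_1 = … = p_{k−1} = 0` and `p_k = 1`** — by the solved form `p_k = −k·m_{d−k} − Σ_{0<i<k} m_{d−i} p_{k−i}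
= 0`. -/
theorem dualSeq_derivative_ne_single_of_cast_eq_zero {k d : ℕ} (hk : (k : K) = 0) (hk1 : 1 ≤ k) (hkd : k ≤ d) {m : K[X]} (hm : m.Monic) (hmd : m.natDegree = d)
    (hq : ∀ j, 1 ≤ j → j < k → dualSeq K m (derivative m) j = 0) : dualSeq K m (derivative m) k ≠ 1 := by
  rw [dualSeq_derivative_eq_newton K hm hk1 (by omega), hk, zero_mul, neg_zero, zero_sub, Finset.sum_eq_zero fun i hi => ?_, neg_zero]
  · exact zero_ne_one
  · rw [Finset.mem_Ico] at hi
    rw [hq (k - i) (by omega) (by omega), mul_zero]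

/-- If some `k` with `1 ≤ k ≤ d` vanishes in `K` then the characteristic `p = ringChar K` satisfies `(p : K) = 0`, `1 ≤ p ≤ d`. -/
theorem exists_ringChar_le_of_cast_eq_zero {k d : ℕ} (hk : (k : K) = 0) (hk1 : 1 ≤ k) (hkd : k ≤ d) : ((ringChar K : ℕ) : K) = 0 ∧ 1 ≤ ringChar K ∧ ringChar K ≤ d := by
  have hdvd : ringChar K ∣ k := (ringChar.spec K k).mp hk
  have hp0 : ringChar K ≠ 0 := fun h0 => by rw [h0, zero_dvd_iff] at hdvd; omega
  exact ⟨ringChar.Nat.cast_ringChar, Nat.one_le_iff_ne_zero.mpr hp0, (Nat.le_of_dvd (by omega) hdvd).trans hkd⟩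

/-- **THE EQUIVALENCE (i) ⟺ (ii): `1, …, d` are non-zero in `K` iff the Newton sums `p_1, …, p_d` SEPARATE the monic polynomials of degree `d`.** -/
theorem forall_cast_ne_zero_iff_injective (d : ℕ) :
    (∀ k : ℕ, 1 ≤ k → k ≤ d → (k : K) ≠ 0) ↔
      ∀ m₁ m₂ : K[X], m₁.Monic → m₂.Monic → m₁.natDegree = d → m₂.natDegree = d →
        (∀ j, 1 ≤ j → j ≤ d → dualSeq K m₁ (derivative m₁) j = dualSeq K m₂ (derivative m₂) j) → m₁ = m₂ := by
  refine ⟨fun h m₁ m₂ hm₁ hm₂ hd₁ hd₂ hp => eq_of_dualSeq_derivative_eq K hm₁ hm₂ (hd₁.trans hd₂.symm) (fun k hk hkd => h k hk (hd₁ ▸ hkd)) fun j hj hjd => hp j hj (hd₁ ▸ hjd), fun h => ?_⟩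
  by_contra hneg
  push Not at hneg
  obtain ⟨k, hk1, hkd, hk⟩ := hneg
  obtain ⟨hp, hp1, hpd⟩ := exists_ringChar_le_of_cast_eq_zero K hk hk1 hkd
  have hmon : ((Polynomial.X : K[X]) ^ (d - ringChar K) * (Polynomial.X - C 1) ^ ringChar K).Monic := (Polynomial.monic_X_pow _).mul ((Polynomial.monic_X_sub_C 1).pow _)
  have hdeg : ((Polynomial.X : K[X]) ^ (d - ringChar K) * (Polynomial.X - C 1) ^ ringChar K).natDegree = d := by
    rw [Polynomial.natDegree_mul (Polynomial.monic_X_pow _).ne_zero ((Polynomial.monic_X_sub_C 1).pow _).ne_zero, Polynomial.natDegree_X_pow, Polynomial.natDegree_pow,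
      Polynomial.natDegree_X_sub_C, mul_one]
    omega
  exact (dualSeq_derivative_X_pow_mul_eq_of_cast_eq_zero K d hp hp1 le_rfl).2
    (h _ _ hmon (Polynomial.monic_X_pow d) hdeg (Polynomial.natDegree_X_pow d) fun j hj _ => (dualSeq_derivative_X_pow_mul_eq_of_cast_eq_zero K d hp hp1 hj).1)

/-- **THE EQUIVALENCE (i) ⟺ (iii): `1, …, d` are non-zero in `K` iff EVERY `d`-tuple is the Newton-sum vector `(p_1, …, p_d)` of some monic polynomial of degree `d`.** -/
theorem forall_cast_ne_zero_iff_surjective (d : ℕ) :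
    (∀ k : ℕ, 1 ≤ k → k ≤ d → (k : K) ≠ 0) ↔
      ∀ q : ℕ → K, ∃ m : K[X], m.Monic ∧ m.natDegree = d ∧ ∀ j, 1 ≤ j → j ≤ d → dualSeq K m (derivative m) j = q j := by
  refine ⟨fun h q => exists_monic_dualSeq_derivative_eq K d h q, fun h => ?_⟩
  by_contra hneg
  push Not at hneg
  obtain ⟨k, hk1, hkd, hk⟩ := hneg
  obtain ⟨m, hm, hmd, hmq⟩ := h fun j => if j = k then 1 else 0
  have h1 : dualSeq K m (derivative m) k = 1 := by rw [hmq k hk1 hkd, if_pos rfl]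
  exact dualSeq_derivative_ne_single_of_cast_eq_zero K hk hk1 hkd hm hmd (fun j hj hjk => by rw [hmq j hj (by omega), if_neg (by omega)]) h1

end Summit.Ventures.HSemireg.Wedge.HankelOuter
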